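import Summits.ABC.IUTFork.Joshi.LogVolumesHullsLocus

/-!
# [J-III] (9.9.2)–(9.9.4) and the sup-norm step as SUPPORT rows: E-t4's remaining inputs DERIVED from named
# object-level inputs; and a LOCATION of the exponent normalisation (`j²` vs `j²/ℓ*²`)

K. Joshi, *Construction of Arithmetic Teichmüller Spaces III* (arXiv:2401.13508 **v4**, unrefereed; bib
`Joshi2024ATS3`; render `HOME/lit/renders/Joshi-arxiv-2401.13508/pNNNN.txt`), proof of Thm. 9.9.1, p.120 l.99 – p.121
l.166, and proof of Thm. 9.11.1, p.127 l.33–55. Cell abc-iut, block E (rung LADDER-ABC:A2.E), seat E-t23 (slot T-23),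
E-plan-2 ruling R-a (06:20:25Z): «(9.9.2)–(9.9.6) … as SUPPORT rows … proofs of E-t4's hypothesis Props where
derivable». E-t4's carrier `ATS3.LocusDatum ℓ*` (p428048) reads Thm. 9.9.1 / 9.11.1 at a place `w` from THREE named
predicates: `ValuationScaling` (= (9.9.4) folded with (9.9.2)–(9.9.3)), `StandardPointInLocus`,
`HullVolumeLowerBound`. The last was DERIVED in `LogVolumesHullsLocus` (p429037) from the typed Lem. 9.10.7.1. Here
the other two are DERIVED for the projection `toLocusDatum` of a `ScalingDatum` (the exhibited-element datum + the
Tate-parameter roots `q^{1/2ℓ}_{w;j} ∈ L′_{w,j}` + the set of norms of the `w`-locus), from NAMED object-level inputs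
each carrying its printed locator and its owning seat: `NormLogBK` = (9.9.2)–(9.9.3) (Lem. 9.8.2.7, seat T-22;
(9.7.2.2), seat T-21), `RootScaling e` = (9.9.4) with the exponent law `e` as a PARAMETER (Thm. 4.2.2.1 (4), seat
T-07, at the standard point, §4.5), `CrossNorm` = §7.6.2 (seat T-14) + Thm-Def 9.8.1.1 (5) membership (seat T-22).
Net: E-t4's spine at `w` rests on {`NormLogBK`, `RootScaling scalingExponent`, `CrossNorm`, sign convention} + the
signature fields. LOCATION (numbers, no verdict): print carries two exponent displays — Thm. 4.2.2.1 (4) p.33 l.3–12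
«|−|_{K′_{w,j}} = |−|^{j²}_{K′_{w,1}}» (seat T-07, `AdelicCurveDatum.ValuationScaling`) and (9.9.4) p.121 l.39–66 «=
|q^{1/2ℓ}_{w;1}|^{j²/ℓ*²} _{L′_{w,1}}». Seat T-07's `AdelicCurveDatum.absK_eq_rpow_scalingExponent` (p429452)
reconciles them as `|t|_{K′_{w,j}} = |t|_{K′_{w,ℓ*}}^{(j/ℓ*)²}` — exponent `j²/ℓ*²` with the base read at the STANDARD
component `j = ℓ*` (`y_{ℓ*} = y′_0`, §4.5), exponent `j²` with the base at `j = 1`. E-t4's `qroot` (the `|q_w^{1/2ℓ}|`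
of Thm. 9.9.1's right side, Thm. 7.3.1 normalisation `|π_w| = p_w^{−1}`) is thus the base AT `j = ℓ*`, while (9.9.4)
prints the base «_{L′_{w,1}}». `literalDatum_profile`: a two-label datum with base at `j = 1` and law `j²` satisfies
`StandardPointInLocus`, `HullVolumeLowerBound` (with equality) and the sign convention, and BOTH estimates FAIL there
— so WHICH component carries the standard absolute value is load-bearing for this route; graded by E-ref
(faithfulness), not here. FRAMING: typed ≠ proved; no side taken on [IUTchIII] Cor. 3.12 or on any author; Joshi's
inputs are hypotheses BY NAME / signature fields, never asserted. -/

noncomputable section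

namespace Summit.ABC.IUTFork.Joshi.LogVol

open MeasureTheory

/-- **The scaling datum at a place `w`**: the exhibited-element datum (`LogVolumesHullsLocus`) together with the
Tate-parameter roots `q^{1/2ℓ}_{w;j} ∈ L′_{w,j}` of the holomorphoids `y_j` of the standard point ((9.9.2), p.120
l.106–130: «log_{L′_w}(1 + p*·q^{1/2ℓ}_{w;j})/p*»), the SET of tensor norms of the elements of the `w`-locus
((9.8.2.4)–(9.8.2.5), p.117 l.32–48; bounded: Cor. 9.8.2.6, p.117 l.128–131) whose `sup` IS the carried `supNorm`,
and the tensor norm of the exhibited element `⊗_j τ_j`, a member of that set (Thm-Def 9.8.1.1 (5), p.115 l.50 –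
p.116 l.52: the locus contains the class of `z_Θ`). SIGNATURE (fields = printed inputs with locators).
[claim: Joshi2024ATS3, status: disputed] -/
structure ScalingDatum (lstar : ℕ) (E : Fin lstar → Type*) [∀ i, Field (E i)] [∀ i, MeasurableSpace (E i)]
    (X : Type*) [MeasurableSpace X] extends ExhibitedDatum lstar E X where
  /-- `q^{1/2ℓ}_{w;j} ∈ L′_{w,j}` (p.120 l.120–121) -/ qrt : ∀ i, E i
  /-- `{|x| : x ∈ Θ̃^𝓘_{Mochizuki,w}}`, the tensor norms over the locus ((9.8.2.4)–(9.8.2.5)) -/ locusNorms : Set ℝ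
  /-- Cor. 9.8.2.6: the norms over the locus are bounded -/ locusNorms_bdd : BddAbove locusNorms
  /-- (9.8.2.5): `|Θ̃^𝓘_{Mochizuki,w}| = sup` of the norms over the locus -/ supNorm_eq : supNorm = sSup locusNorms
  /-- `|τ_1 ⊗ … ⊗ τ_{ℓ*}|`, the tensor norm of the exhibited element -/ tensorNorm : ℝ
  /-- Thm-Def 9.8.1.1 (5): the exhibited element lies in the locus, so its norm is among `locusNorms` -/
  tensorNorm_mem : tensorNorm ∈ locusNorms

namespace ScalingDatum

variable {lstar : ℕ} {E : Fin lstar → Type*} [∀ i, Field (E i)] [∀ i, MeasurableSpace (E i)] {X : Type*}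
  [MeasurableSpace X] (Dw : ScalingDatum lstar E X)

/-- **(9.9.2)–(9.9.3)** (p.120 l.106 – p.121 l.36): «|log_BK(ξ_{w,j})|_{L′_{w,j}} = |log_{L′_w}(1 +
p*·q^{1/2ℓ}_{w;j})/p*| … By Lemma 9.8.2.7 one has … = |q^{1/2ℓ}_{w;j}|_{L′_{w,j}} for j = 1, …, ℓ*» — INPUT (Lem.
9.8.2.7: seat T-22; the value (9.7.2.2) of `log_BK`: seat T-21). Hypothesis BY NAME, never asserted. 
[claim: Joshi2024ATS3, status: disputed] -/
@[claim "Joshi2024ATS3" "disputed"]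
def NormLogBK : Prop := ∀ i, (Dw.D i).abs (Dw.τ i) = (Dw.D i).abs (Dw.qrt i)

/-- **(9.9.4) with exponent law `e`** (p.121 l.37–66: «by the valuation scaling property Theorem 4.2.2.1(4) one
obtains |q^{1/2ℓ}_{w;j}|_{L′_{w,j}} = |q^{1/2ℓ}_{w;1}|^{j²/ℓ*²}_{L′_{w,1}} … (writing q_w in place of q_{w;1})»): the
norm of the `j`-th root is `|q_w^{1/2ℓ}|^{e(j)}`. The exponent law is a PARAMETER: print's (9.9.4) is `e =
scalingExponent` (`j²/ℓ*²`, E-t4); Thm. 4.2.2.1 (4) read literally (seat T-07) is `e(j) = j²`. INPUT, never asserted.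
[claim: Joshi2024ATS3, status: disputed] -/
@[claim "Joshi2024ATS3" "disputed"]
def RootScaling (e : Fin lstar → ℝ) : Prop := ∀ i, (Dw.D i).abs (Dw.qrt i) = Dw.qroot ^ e i

/-- **The cross-norm identity for the exhibited element** (§7.6.2, invoked p.120 l.54–76: «the cross-norm property …
|⊗_{w|p} a_w| = ∏_{w|p} |a_w|_{L′_w}»; here across the labels `j` at `w`, as in (9.8.2.2)): `|⊗_j τ_j| = ∏_j |τ_j|`.
INPUT (seat T-14), never asserted. [claim: Joshi2024ATS3, status: disputed] -/
@[claim "Joshi2024ATS3" "disputed"]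
def CrossNorm : Prop := Dw.tensorNorm = ∏ i, (Dw.D i).abs (Dw.τ i)

/-- **E-t4's `ValuationScaling` DERIVED** for the projection from (9.9.2)–(9.9.3) and (9.9.4)-with-`scalingExponent`.
[claim: Joshi2024ATS3, status: disputed] -/
theorem valuationScaling_of (h1 : Dw.NormLogBK) (h2 : Dw.RootScaling (ATS3.LocusDatum.scalingExponent lstar)) :
    Dw.toLocusDatum.ValuationScaling := fun i => by
  rw [ExhibitedDatum.toLocusDatum_theta, h1 i, h2 i]; rfl

/-- **E-t4's `StandardPointInLocus` DERIVED** for the projection from the cross-norm identity, membership of the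
exhibited element in the locus and boundedness of the locus norms (`le_csSup`). 
[claim: Joshi2024ATS3, status: disputed] -/
theorem standardPointInLocus_of (h : Dw.CrossNorm) : Dw.toLocusDatum.StandardPointInLocus := by
  unfold ATS3.LocusDatum.StandardPointInLocus
  change ∏ i, (Dw.D i).abs (Dw.τ i) ≤ Dw.supNorm
  rw [← h, Dw.supNorm_eq]
  exact le_csSup Dw.locusNorms_bdd Dw.tensorNorm_mem

/-- **Thm. 9.9.1 at `w` for the projection** from the three named object-level inputs (E-t4's
`fundamentalEstimateSup_of`, both inputs discharged). [claim: Joshi2024ATS3, status: disputed] -/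
theorem fundamentalEstimateSup_of_inputs (h1 : Dw.NormLogBK)
    (h2 : Dw.RootScaling (ATS3.LocusDatum.scalingExponent lstar)) (h3 : Dw.CrossNorm) :
    Dw.toLocusDatum.FundamentalEstimateSup :=
  Dw.toLocusDatum.fundamentalEstimateSup_of (Dw.valuationScaling_of h1 h2) (Dw.standardPointInLocus_of h3)

/-- **Thm. 9.11.1 at `w` for the projection** from `NormLogBK` and `RootScaling scalingExponent` alone
(`HullVolumeLowerBound` was discharged in `LogVolumesHullsLocus`). [claim: Joshi2024ATS3, status: disputed] -/
theorem fundamentalEstimateVol_of_inputs (h1 : Dw.NormLogBK)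
    (h2 : Dw.RootScaling (ATS3.LocusDatum.scalingExponent lstar)) : Dw.toLocusDatum.FundamentalEstimateVol :=
  Dw.toExhibitedDatum.fundamentalEstimateVol_of_valuationScaling (Dw.valuationScaling_of h1 h2)

/-- **Cor. 9.11.1.1 at `w` for the projection** from the two scaling inputs and the sign convention.
[claim: Joshi2024ATS3, status: disputed] -/
theorem cor91111_of_inputs (h1 : Dw.NormLogBK) (h2 : Dw.RootScaling (ATS3.LocusDatum.scalingExponent lstar))
    (h3 : Dw.toLocusDatum.LogVolNonpos) : Dw.toLocusDatum.Cor91111 :=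
  Dw.toExhibitedDatum.cor91111_of_valuationScaling (Dw.valuationScaling_of h1 h2) h3

end ScalingDatum

/-! ## LOCATION: the literal `j²` exponent law does not carry the route (a two-label numerical profile) -/

/-- The exponent law with the base read AT `j = 1` (as (9.9.4) prints «_{L′_{w,1}}») composed with Thm. 4.2.2.1 (4)
«|−|_{K′_{w,j}} = |−|^{j²}_{K′_{w,1}}»: `|log_BK(ξ_{w,j})| = qroot^{j²}`. Reading predicate on E-t4's carrier, never
asserted; contrast `ATS3.LocusDatum.ValuationScaling` (base at `j = ℓ*`, exponent `j²/ℓ*²`). 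
[claim: Joshi2024ATS3, status: disputed] -/
@[claim "Joshi2024ATS3" "disputed"]
def LiteralScaling {lstar : ℕ} (d : ATS3.LocusDatum lstar) : Prop :=
  ∀ i : Fin lstar, d.theta i = d.qroot ^ (((i : ℕ) + 1) ^ 2)

/-- Two labels (`ℓ* = 2`), `|q_w^{1/2ℓ}| = 1/2`, exhibited norms `(1/2, 1/16) = ((1/2)^{1²}, (1/2)^{2²})`, sup-norm and
hull-volume both `1/32 = ∏_j |τ_j|` (the exhibited element accounts for all of them). [folklore] -/
def literalDatum : ATS3.LocusDatum 2 where
  qroot := 1 / 2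
  qroot_pos := by norm_num
  qroot_lt_one := by norm_num
  theta := fun i => (1 / 2 : ℝ) ^ (((i : ℕ) + 1) ^ 2)
  supNorm := 1 / 32
  hullVol := 1 / 32

/-- The product of the two exhibited norms of `literalDatum` is `1/32`. [folklore] -/
theorem literalDatum_prod : ∏ i, literalDatum.theta i = 1 / 32 := by
  rw [Fin.prod_univ_two]
  norm_num [literalDatum]

/-- **LOCATION, PROVED (numbers, no verdict):** at `literalDatum` the literal-`j²` scaling, `StandardPointInLocus`,
`HullVolumeLowerBound` and the sign convention `LogVolNonpos` all hold, yet Thm. 9.9.1 and Thm. 9.11.1 (at `w`) both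
FAIL: `(1/2)² = 1/4 > 1/32`. Hence the inputs with the base at `j = 1` do NOT imply the estimate by this route, while
with the base at `j = ℓ*` (`scalingExponent`) they do (`fundamentalEstimateVol_of_inputs`): the choice of the
standard component (§4.5 `y_{ℓ*} = y′_0`) is load-bearing. No verdict on print. [folklore] -/
theorem literalDatum_profile :
    LiteralScaling literalDatum ∧ literalDatum.StandardPointInLocus ∧ literalDatum.HullVolumeLowerBound ∧
      literalDatum.LogVolNonpos ∧ ¬ literalDatum.FundamentalEstimateSup ∧ ¬ literalDatum.FundamentalEstimateVol := by
  refine ⟨fun i => rfl, ?_, ?_, ?_, ?_, ?_⟩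
  · show ∏ i, literalDatum.theta i ≤ literalDatum.supNorm
    rw [literalDatum_prod]; norm_num [literalDatum]
  · show ∏ i, literalDatum.theta i ≤ literalDatum.hullVol
    rw [literalDatum_prod]; norm_num [literalDatum]
  · show literalDatum.hullVol ≤ 1
    norm_num [literalDatum]
  · show ¬ literalDatum.qroot ^ 2 ≤ literalDatum.supNorm
    norm_num [literalDatum]
  · show ¬ literalDatum.qroot ^ 2 ≤ literalDatum.hullVol
    norm_num [literalDatum]

/-- … whereas E-t4's `(j/ℓ*)²`-law FAILS at `literalDatum` (consistency check: the two laws differ already at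
`ℓ* = 2`, `j = 1`: `(1/2)^{1/4} ≠ 1/2`). [folklore] -/
theorem literalDatum_not_valuationScaling : ¬ literalDatum.ValuationScaling := fun h =>
  absurd (literalDatum.fundamentalEstimateVol_of h literalDatum_profile.2.2.1) literalDatum_profile.2.2.2.2.2

end Summit.ABC.IUTFork.Joshi.LogVol

end
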